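import Mathlib
import Summits.Langlands.Langlands.Theses.NonParallelVoid
import Literature.NumberTheory.GaloisRepresentations.EnormousSubgroup
import Literature.NumberTheory.GaloisRepresentations.ProjectiveType
import Literature.NumberTheory.GaloisRepresentations.DecomposedGeneric
import Literature.NumberTheory.GaloisRepresentations.AbsGaloisGroup
import Literature.NumberTheory.Automorphic.Qian2022PotentialAutomorphy
import HarnessLib

/-!
# Line `qian-transfer` — crux `TensorSquareParallel` (item stmt-Langlands-17009) of route `NonParallelVoid`

Crux-strategist seat `planner-cstrat-stmt-Langlands-17009-b1-0`, 2026-08-17 (alternative to the registered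
line `Lines/birth.lean`; published as `Cruxes/TensorSquareParallel/Lines/qian-transfer.lean`).

The crux ("CALEGARI'S TENSOR, NON-ORDINARY"): `F` imaginary quadratic, `p ≥ 11` split, `ρ : Γ_F → GL₂(ℚ̄_p)`
irreducible, a.e. unramified, crystalline above `p` with labelled Hodge–Tate weights `{a_v < b_v}`,
`ρ̄|Γ_{F(ζ_p)}` absolutely irreducible, odd gap sum, `ρ̄` NOT of base-change type ⟹ parallel gaps (void).
The birth line (tensor induction `ψ = ⊗-Ind ρ` + [BLGGT] Thm. C + Caraiani–Le Hung) stops on the locus where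
`ρ̄|Γ_{F(ζ_p)}` is PROJECTIVELY DIHEDRAL (`ψ̄` residually reducible) — its open `stub_dihedralCorner`.

THIS LINE = the TRANSFER lens at crux level.  The solved sibling of this step is the ORDINARY case; its modern
form — Qian 2023 Thm. 1.4 (potential automorphy of a single ordinary `ℓ`-adic representation of `Γ_K`, `K` CM,
vendored as `Qian2022.potentialAutomorphy_ordinary`; engine: Dwork-family residual potential automorphy +
ACC+ 2023 Thm. 6.1.2) — never leaves `GL₂/F`, needs NO residual automorphy and NO big image: only
"`ρ̄(Γ_{F(ζ_p)})` ENORMOUS" (ACC+ Def. 6.2.28) + decomposed generic + a scalar `ρ̄(σ)`, `σ ∉ Γ_{F(ζ_p)}`.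
The observation with teeth: DIHEDRAL IMAGES OF ORDER PRIME TO `p` ARE ENORMOUS (`stub_isEnormous_of_isDihedralType`:
no `p`-quotient, `H⁰ = H¹ = 0`, and reflections are regular semisimple with a fixed vector on `Ind(θ/θˢ) ⊂ ad⁰`);
decomposed genericity is Caraiani–Newton Lemma 6.2.2 (PROVED in the tree, `DecomposedGenericOfQuadratic`); the
scalar element is ACC+ Rem. 6.1.4 (`D_m`, `A₄ ⊂ S₄` have no cyclic quotient of order `p − 1 ≥ 10`).  Potential
automorphy of `ρ|Γ_{K'}` over a CM field `K'` plus Clozel's purity lemma (and the Hodge–Tate weights of `r_ι(π)`,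
A'Campo–Hevesi–Thorne–Whitmore 2026 Thm. 1.2.1) forces the gaps at conjugate-paired places to agree: `m = n`,
contradicting the odd gap sum.  So the NEARLY ORDINARY half of the dihedral corner closes, and the open
remainder of the crux shrinks to the SUPERSINGULAR dihedral corner (`stub_supersingularDihedral`), the dark core
(the torsion-fed emptiness of the sibling crux `EmptyWeightCore`, or overconvergent classicality, nothing in print).

Stubs (7):
* `stub_genericSector` — the crux off the dihedral locus: OWNED BY THE BIRTH LINE (its stubs 1–4 compose to
  exactly this statement: `Lines/birth.lean`, `TensorSquareParallel_of` with the corner hypothesis negated);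
  stated here as one stub so that this skeleton concludes the crux by name without re-registering them (XL).
* `stub_dihedralType_of_trace` — the trace predicate (`tr ρ̄ = η · tr ρ̄` on `Γ_{F(ζ_p)}`, `η ≠ 1`) + absolute
  irreducibility ⟹ `ρ̄|Γ_{F(ζ_p)}` has projective image `D_m`, `m ≥ 2`, finite of order prime to `p` (Clifford /
  character theory; M).
* `stub_isEnormous_of_isDihedralType` — dihedral type, order prime to `p ≠ 2` ⟹ enormous (group theory; M).
  FIRST LEMMA WITH TEETH.
* `stub_qianResidualPackage` — hypotheses (iii)–(iv) of Qian Thm. 1.4 for `τ = ρ̄`: residual rep, absolutely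
  irreducible, decomposed generic (Caraiani–Newton 6.2.2), `τ|Γ_{F(ζ_p)}` absolutely irreducible and enormous
  (given), scalar `ρ̄(σ)` with `σ ∉ Γ_{F(ζ_p)}` (Rem. 6.1.4) (bookkeeping + two small lemmas; L).
* `stub_qianPotentialAutomorphy` — Qian 2023 Thm. 1.4 for `n = 2` over `F` at the pinned data, with its
  hypothesis (ii) "potentially semistable, ordinary with regular Hodge–Tate weights" discharged from: crystalline
  (pinned datum) + an invariant line at every `v ∣ p` + two distinct labelled weights (a non-split crystalline
  extension carries the smaller Hodge–Tate number on the invariant line; split: choose the flag) (citation-grade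
  fact + a local lemma; XL as a formalisation).
* `stub_purityContradiction` — `ρ|Γ_{K'}` automorphic (`≅ r_ι(π)`, `π` regular algebraic cuspidal on `GL₂(𝔸_{K'})`,
  `K'` CM Galois over `F`) and two labels of `ρ` above `p` with different gaps ⟹ `False` (HLTT uniqueness +
  AHTW 2026 Thm. 1.2.1 + Clozel 1990 purity lemma: gaps at `σ` and `cσ` agree; citation-grade).
* `stub_supersingularDihedral` — the crux on the locus "projectively dihedral AND no invariant line at some
  `v ∣ p`": OPEN (honest remainder; = sector S of the strategist split, evidence `Split.lean`).

`TensorSquareParallel_of (h₁ … h₇) : TensorSquareParallel` is KERNEL-CHECKED (no sorry outside `stub_*`):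
`by_cases` on the dihedral predicate; off it, stub 1; on it, `by_cases` on near-ordinarity; supersingular:
stub 7; nearly ordinary: the odd-gap clause gives two labels with different gaps, stub 2 the dihedral type and
coprimality, stub 3 enormousness, stub 4 Qian's residual package, stub 5 a CM field `K'` with `ρ|Γ_{K'}`
automorphic, stub 6 the contradiction.

Disproof used: none on file for this crux (no `Disproof.lean`, no `Theorems/TensorSquareParallel/Negative`,
2026-08-17); `ledger negatives --problem Langlands` (4 entries) unrelated.  Dead lines: none.

References: L. Qian, *Potential automorphy for GL_n*, Invent. Math. 231 (2023), Thm. 1.4 [Qian2022];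
P. Allen et al. (ACC+), Ann. of Math. 197 (2023) = arXiv:1812.09999, Thm. 6.1.2, Rem. 6.1.3–6.1.4, Def. 6.2.28,
Lemma 6.2.29 [ACCGHLNSTT2023]; A. Caraiani, J. Newton, arXiv:2301.10509, Lemma 6.2.2 [CaraianiNewton2023];
L. Clozel, *Motifs et formes automorphes*, Perspect. Math. 10 (1990), Lemme 4.9 [Clozel1990]; L. A'Campo,
B. Hevesi, J. Thorne, D. Whitmore, arXiv:2607.11763, Thm. 1.2.1; F. Calegari, Invent. Math. 185 (2011) =
arXiv:0907.3427, §2 and Thm. 1.4 [Calegari2010]; F. Calegari, B. Mazur, JIMJ 8 (2009), Conj. 1.3 [CalegariMazur2008].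
-/

noncomputable section

set_option linter.dupNamespace false

open scoped NumberField
open IsDedekindDomain Field
open Literature.NumberTheory.GaloisRepresentations Literature.NumberTheory.PAdicHodge
  Literature.NumberTheory.Automorphic

namespace Summit.Langlands.Langlands.Cruxes.TensorSquareParallel.QianTransfer

/-- **stub 1 — the generic sector (owner: the birth line).**  The crux restricted to `ρ̄|Γ_{F(ζ_p)}` NOT
projectively dihedral (no character `η ≠ 1` of `Γ_{F(ζ_p)}` with `tr ρ̄ = η · tr ρ̄` there).  This is exactly
what stubs 1–4 of `Lines/birth.lean` compose to (Calegari's tensor induction `ψ = ⊗-Ind ρ`, regular because the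
gaps differ, `GO₄` with totally even multiplier, potentially diagonalisable; Clifford theory: not base-change type
and not dihedral ⟹ `ψ̄|Γ_{ℚ(ζ_p)}` absolutely irreducible; [BLGGT] Thm. C with `l ≥ 2(n+1) = 10`; Caraiani–Le Hung
Thm. 1.1, `n = 4` even ⟹ `tr ψ(c) = 0`, against `tr ψ(c) = 2`).  Kept as ONE stub so that this skeleton does
not re-register the birth stubs; whoever closes birth stubs 1–4 closes it (= child `TensorSquareGeneric` of the
strategist split).  Size XL (planned elsewhere).
[cite: Calegari2010, §2] [cite: BarnetlambEtAl2014, Thm. C] [cite: CaraianiLehung2016, Thm 1.1] -/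
theorem stub_genericSector :
    ∀ (F : Type) [Field F] [NumberField F] [Algebra.IsQuadraticExtension ℚ F], NumberField.IsTotallyComplex F → ∀ (p : ℕ) [Fact p.Prime] (ρ : FramedGaloisRep F (PadicAlgCl p) 2), ρ.toGaloisRep.IsIrreducible → (∀ᶠ v : HeightOneSpectrum (𝓞 F) in Filter.cofinite, ρ.IsUnramifiedAt v) → (∀ (v : HeightOneSpectrum (𝓞 F)) (hv : ((p : ℕ) : 𝓞 F) ∈ v.asIdeal), (fontainePstAdicCompletion v p hv).IsDeRhamFramed (ρ.toLocal v) ∧ (letI := (fontainePstAdicCompletion v p hv).algebra; ∀ τ : v.adicCompletion F →ₐ[ℚ_[p]] PadicAlgCl p, ∃ a b : ℤ, a < b ∧ ρ.labelledHodgeTateWeightsAt v (fontainePstAdicCompletion v p hv).algebra (fontainePstAdicCompletion v p hv).𝔅 τ.toRingHom = {a, b})) → (11 ≤ p ∧ (∃ v w : HeightOneSpectrum (𝓞 F), v ≠ w ∧ ((p : ℕ) : 𝓞 F) ∈ v.asIdeal ∧ ((p : ℕ) : 𝓞 F) ∈ w.asIdeal) ∧ (∀ (v : HeightOneSpectrum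 (𝓞 F)) (hv : ((p : ℕ) : 𝓞 F) ∈ v.asIdeal), (fontainePstAdicCompletion v p hv).IsCrystallineFramed (ρ.toLocal v)) ∧ FramedGaloisRep.IsResiduallyAbsIrreducible (ρ.restrictField (CyclotomicField p F))) → ¬ (∀ (v : HeightOneSpectrum (𝓞 F)) (hv : ((p : ℕ) : 𝓞 F) ∈ v.asIdeal) (w : HeightOneSpectrum (𝓞 F)) (hw : ((p : ℕ) : 𝓞 F) ∈ w.asIdeal), letI := (fontainePstAdicCompletion v p hv).algebra; letI := (fontainePstAdicCompletion w p hw).algebra; ∀ (τ : v.adicCompletion F →ₐ[ℚ_[p]] PadicAlgCl p) (σ : w.adicCompletion F →ₐ[ℚ_[p]] PadicAlgCl p) (a b a' b' : ℤ), ρ.labelledHodgeTateWeightsAt v (fontainePstAdicCompletion v p hv).algebra (fontainePstAdicCompletion v p hv).𝔅 τ.toRingHom = {a, b} → a < b → ρ.labelledHodgeTateWeightsAt w (fontainePstAdicCompletion w p hw).algebra (fontainePstAdicCompletion w p hw).𝔅 σ.toRingHom = {a', b'} → a' < b' → Even (b - a + (b' - a'))) → ¬ (∃ τ : absoluteGaloisGroup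 ℚ, τ ∉ Set.range (absGaloisRestrict ℚ F) ∧ ∃ χ : absoluteGaloisGroup F →* (padicAlgClResidueField p)ˣ, ∀ σ σ' : absoluteGaloisGroup F, absGaloisRestrict ℚ F σ' = τ * absGaloisRestrict ℚ F σ * τ⁻¹ → (ρ.residualRep σ').val.trace = (χ σ : padicAlgClResidueField p) * (ρ.residualRep σ).val.trace ∧ (ρ.residualRep σ').val.det = (χ σ : padicAlgClResidueField p) ^ 2 * (ρ.residualRep σ).val.det) → ¬ (∃ η : absoluteGaloisGroup (CyclotomicField p F) →* (padicAlgClResidueField p)ˣ, η ≠ 1 ∧ ∀ σ : absoluteGaloisGroup (CyclotomicField p F), (ρ.residualRep (absGaloisRestrict F (CyclotomicField p F) σ)).val.trace = (η σ : padicAlgClResidueField p) * (ρ.residualRep (absGaloisRestrict F (CyclotomicField p F) σ)).val.trace) → ∃ g : ℤ, ∀ (v : HeightOneSpectrum (𝓞 F)) (hv : ((p : ℕ) : 𝓞 F) ∈ v.asIdeal), letI := (fontainePstAdicCompletion v p hv).algebra; ∀ τ : v.adicCompletion F →ₐ[ℚ_[p]] PadicAlgCl p, ∃ a : ℤ, ρ.labelledHodgeTateWeightsAt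 v (fontainePstAdicCompletion v p hv).algebra (fontainePstAdicCompletion v p hv).𝔅 τ.toRingHom = {a, a + g} := by
  sorry

/-- **stub 2 — the trace predicate means projectively dihedral** (Clifford / character theory).  If
`ρ̄|Γ_{F(ζ_p)}` is absolutely irreducible and `tr ρ̄ = η · tr ρ̄` on `Γ_{F(ζ_p)}` for a character `η ≠ 1`, then
the restriction `ρ̄_K := ρ̄|Γ_{F(ζ_p)}` (the chosen residual representation `ρ.residualRep` composed with the
inclusion of `Γ_{F(ζ_p)} = absGaloisGroupAdjoinRootsOfUnity F p`, cf.
`range_absGaloisRestrict_eq_absGaloisGroupAdjoinRootsOfUnity`) has FINITE image of order PRIME TO `p` and is of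
DIHEDRAL TYPE (projective image `≅ D_m`, `m ≥ 2`, `D₂ = V₄` included).  Proof sketch: `η(σ) = 1` whenever
`tr ρ̄(σ) ≠ 0`, so `η` factors through the finite image `Γ` and `tr ρ̄` vanishes off `N = ker η` (index `r ≥ 2`);
if `p ∣ |Γ|` the image contains `SL₂(𝔽_q)` (Dickson; absolute irreducibility) whose `𝔽_p`-span is `M₂`, so no
coset of a proper normal subgroup is trace-zero — hence `p ∤ |Γ|`; then orthogonality gives
`⟨χ|_N, χ|_N⟩ = r ∈ {2, 4}`, i.e. `ρ̄_K` is induced from an index-two subgroup (`r = 2`) or has projective image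
`V₄` (`r = 4`): dihedral type either way.  Size M.
[cite: ACCGHLNSTT2023, Def. 6.2.28 (context)] [cite: Calegari2010, §2] -/
theorem stub_dihedralType_of_trace :
    ∀ (F : Type) [Field F] [NumberField F] [Algebra.IsQuadraticExtension ℚ F], NumberField.IsTotallyComplex F → ∀ (p : ℕ) [Fact p.Prime] (ρ : FramedGaloisRep F (PadicAlgCl p) 2), 11 ≤ p → FramedGaloisRep.IsResiduallyAbsIrreducible (ρ.restrictField (CyclotomicField p F)) → (∃ η : absoluteGaloisGroup (CyclotomicField p F) →* (padicAlgClResidueField p)ˣ, η ≠ 1 ∧ ∀ σ : absoluteGaloisGroup (CyclotomicField p F), (ρ.residualRep (absGaloisRestrict F (CyclotomicField p F) σ)).val.trace = (η σ : padicAlgClResidueField p) * (ρ.residualRep (absGaloisRestrict F (CyclotomicField p F) σ)).val.trace) → IsDihedralType (ρ.residualRep.comp (absGaloisGroupAdjoinRootsOfUnity F p).subtype) ∧ Finite (ρ.residualRep.comp (absGaloisGroupAdjoinRootsOfUnity F p).subtype).range ∧ ¬ p ∣ Nat.card (ρ.residualRep.comp (absGaloisGroupAdjoinRootsOfUnity F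 p).subtype).range := by
  sorry

/-- **stub 3 — FIRST LEMMA WITH TEETH: dihedral images of order prime to `p ≠ 2` are enormous**
(ACC+ Def. 6.2.28 for `n = 2`, over `k = ℤ̄_p/𝔪`; by Lemma 6.2.29 the notion is insensitive to the coefficient
field).  For `ρ' : G → GL₂(k)` with finite image `H` of order prime to `p` and projective image `≅ D_m`, `m ≥ 2`:
(1) a quotient of `p`-power order of `H` is trivial; (2a) `(ad⁰)^H = 0` — dihedral type of order prime to `p`
is absolutely irreducible (Schur); (2b) `H¹(H, ad⁰) = 0` — `|H|` is invertible in `k`; (3) with `C` the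
index-two Cartan preimage, `ρ'|_C = θ ⊕ θ'`, `ad⁰ = ε ⊕ Ind_C^H(θ/θ')`: on `ε` any `h ∈ C` with
`θ(h) ≠ θ'(h)` is regular semisimple and acts trivially; on `Ind(θ/θ')` (irreducible for `m ≥ 3`) an `h ∉ C`,
`ρ'(h) = (0 a; b 0)` in the Cartan basis, acts by `E₁₂ ↦ (b/a)E₂₁`, `E₂₁ ↦ (a/b)E₁₂`, fixes `E₁₂ + (b/a)E₂₁`,
and has characteristic polynomial `X² − ab`, separable as `p ≠ 2`; for `m = 2`, `ad⁰ = ε₁ ⊕ ε₂ ⊕ ε₃` and a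
non-central `h ∈ ker εᵢ` is regular semisimple.  Consequence used by the line: the image hypothesis of
ACC+ Thm. 6.1.2 / Qian Thm. 1.4 holds on the whole dihedral corner.  Size M.
[cite: ACCGHLNSTT2023, Def. 6.2.28 and Lemma 6.2.29] -/
theorem stub_isEnormous_of_isDihedralType :
    ∀ (p : ℕ) [Fact p.Prime], p ≠ 2 → ∀ (G : Type) [Group G] (ρ' : G →* GL (Fin 2) (padicAlgClResidueField p)), Finite ρ'.range → ¬ p ∣ Nat.card ρ'.range → IsDihedralType ρ' → Subgroup.IsEnormous ρ'.range := by
  sorry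

/-- **stub 4 — Qian's residual hypotheses (iii)–(iv) for `τ = ρ̄`.**  For `F` imaginary quadratic,
`p ≥ 11` split in `F`, `ρ̄|Γ_{F(ζ_p)}` absolutely irreducible, of dihedral type and ENORMOUS (stub 3): the chosen
residual representation `ρ.residualRep` IS a residual representation of `ρ` (`residualRep_spec`, rank two:
`exists_semisimplification_fin_two`), is absolutely irreducible, is DECOMPOSED GENERIC (Caraiani–Newton 2023
Lemma 6.2.2 — over a quadratic field absolute irreducibility of `ρ̄|Γ_{F(ζ_p)}` suffices; PROVED in the tree for
`𝔽_p`-coefficients, `DecomposedGenericOfQuadratic`), its restriction to `Γ_{F(ζ_p)}` is absolutely irreducible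
with enormous image (`(…).map ρ̄ = range (ρ̄ ∘ subtype)`), and some `σ ∈ Γ_F ∖ Γ_{F(ζ_p)}` has `ρ̄(σ)` scalar:
by ACC+ Rem. 6.1.4 it suffices that the projective image of `ρ̄(Γ_F)` — which normalises the dihedral
`ρ̄(Γ_{F(ζ_p)})` with cyclic quotient, hence is dihedral or `⊂ S₄` — has no cyclic quotient of order
`[F(ζ_p) : F] = p − 1 ≥ 10` (`p` unramified in `F`).  Size L.
[cite: Qian2022, Thm. 1.4 (iii)-(iv)] [cite: CaraianiNewton2023, Lemma 6.2.2] [cite: ACCGHLNSTT2023, Rem. 6.1.4] -/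
theorem stub_qianResidualPackage :
    ∀ (F : Type) [Field F] [NumberField F] [Algebra.IsQuadraticExtension ℚ F], NumberField.IsTotallyComplex F → ∀ (p : ℕ) [Fact p.Prime] (ρ : FramedGaloisRep F (PadicAlgCl p) 2), 11 ≤ p → (∃ v w : HeightOneSpectrum (𝓞 F), v ≠ w ∧ ((p : ℕ) : 𝓞 F) ∈ v.asIdeal ∧ ((p : ℕ) : 𝓞 F) ∈ w.asIdeal) → FramedGaloisRep.IsResiduallyAbsIrreducible (ρ.restrictField (CyclotomicField p F)) → IsDihedralType (ρ.residualRep.comp (absGaloisGroupAdjoinRootsOfUnity F p).subtype) → Subgroup.IsEnormous (ρ.residualRep.comp (absGaloisGroupAdjoinRootsOfUnity F p).subtype).range → (ρ.IsResidualRepOf (RingHom.id _) ρ.residualRep ∧ IsAbsIrreducible ρ.residualRep ∧ IsDecomposedGeneric ρ.residualRep ∧ IsAbsIrreducible (ρ.residualRep.comp (absGaloisGroupAdjoinRootsOfUnity F p).subtype) ∧ Subgroup.IsEnormous ((absGaloisGroupAdjoinRootsOfUnity F p).map ρ.residualRep) ∧ ∃ σ : absoluteGaloisGroup F, σ ∉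 absGaloisGroupAdjoinRootsOfUnity F p ∧ ∃ c : padicAlgClResidueField p, ((ρ.residualRep σ : GL (Fin 2) (padicAlgClResidueField p)) : Matrix (Fin 2) (Fin 2) (padicAlgClResidueField p)) = c • (1 : Matrix (Fin 2) (Fin 2) (padicAlgClResidueField p))) := by
  sorry

/-- **stub 5 — Qian 2023 Thm. 1.4 for `n = 2` over `F`, with hypothesis (ii) discharged from
near-ordinarity** (citation-grade fact + a local lemma).  For `F` imaginary quadratic (hence CM), `ρ` a.e.
unramified, de Rham at every `v ∣ p` for the pinned Fontaine datum with two distinct labelled Hodge–Tate weights,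
CRYSTALLINE there and with an invariant line at every `v ∣ p`: `ρ|Γ_{F_v}` is potentially semistable and
ordinary with regular Hodge–Tate weights in the sense of Qian Def. 1.2 / ACC+ Thm. 6.1.2 (2)
(`IsOrdinaryRegularAt` at the pinned Artin data): the invariant line is a crystalline character, and a non-split
crystalline extension of HT-regular characters carries the SMALLER Hodge–Tate number on the subobject
(`H¹_f(ℚ_p, χ) ≠ 0` only for `χ` of positive weight), while a split one admits the ordinary flag by choice.  Given
moreover Qian's residual package (stub 4), `Qian2022.potentialAutomorphy_ordinary` (Thm. 1.4, `2 ≤ n = 2`, `K = F`)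
yields a CM number field `K'`, Galois over `F`, with `ρ|Γ_{K'}` automorphic: `≅ r_ι(π)` for a regular algebraic
cuspidal `π` of `GL₂(𝔸_{K'})` (`Qian2022.IsAutomorphic`), for some (any) field isomorphism `ι : ℚ̄_p ≃ ℂ`
(`nonempty_algebraicClosure_padic_ringEquiv_complex`).  Size XL as a formalisation / citation-grade.
[cite: Qian2022, Thm. 1.4 and Def. 1.2] [cite: ACCGHLNSTT2023, Thm. 6.1.2] -/
theorem stub_qianPotentialAutomorphy :
    ∀ (F : Type) [Field F] [NumberField F] [Algebra.IsQuadraticExtension ℚ F], NumberField.IsTotallyComplex F → ∀ (p : ℕ) [Fact p.Prime] (ρ : FramedGaloisRep F (PadicAlgCl p) 2), (∀ᶠ v : HeightOneSpectrum (𝓞 F) in Filter.cofinite, ρ.IsUnramifiedAt v) → (∀ (v : HeightOneSpectrum (𝓞 F)) (hv : ((p : ℕ) : 𝓞 F) ∈ v.asIdeal), (fontainePstAdicCompletion v p hv).IsDeRhamFramed (ρ.toLocal v) ∧ (letI := (fontainePstAdicCompletion v p hv).algebra; ∀ τ : v.adicCompletion F →ₐ[ℚ_[p]] PadicAlgCl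 p, ∃ a b : ℤ, a < b ∧ ρ.labelledHodgeTateWeightsAt v (fontainePstAdicCompletion v p hv).algebra (fontainePstAdicCompletion v p hv).𝔅 τ.toRingHom = {a, b})) → (∀ (v : HeightOneSpectrum (𝓞 F)) (hv : ((p : ℕ) : 𝓞 F) ∈ v.asIdeal), (fontainePstAdicCompletion v p hv).IsCrystallineFramed (ρ.toLocal v)) → (∀ v : HeightOneSpectrum (𝓞 F), ((p : ℕ) : 𝓞 F) ∈ v.asIdeal → FramedRep.HasInvariantCompleteFlag (ρ.toLocal v)) → (ρ.IsResidualRepOf (RingHom.id _) ρ.residualRep ∧ IsAbsIrreducible ρ.residualRep ∧ IsDecomposedGeneric ρ.residualRep ∧ IsAbsIrreducible (ρ.residualRep.comp (absGaloisGroupAdjoinRootsOfUnity F p).subtype) ∧ Subgroup.IsEnormous ((absGaloisGroupAdjoinRootsOfUnity F p).map ρ.residualRep) ∧ ∃ σ : absoluteGaloisGroup F, σ ∉ absGaloisGroupAdjoinRootsOfUnity F p ∧ ∃ c : padicAlgClResidueField p, ((ρ.residualRep σ : GL (Fin 2) (padicAlgClResidueField p)) : Matrix (Fin 2) (Fin 2)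 (padicAlgClResidueField p)) = c • (1 : Matrix (Fin 2) (Fin 2) (padicAlgClResidueField p))) → ∃ (ι : PadicAlgCl p ≃+* ℂ) (K' : Type) (_ : Field K') (_ : NumberField K') (_ : Algebra F K'), IsGalois F K' ∧ NumberField.IsCMField K' ∧ Qian2022.IsAutomorphic ι (ρ.restrictField K') := by
  sorry

/-- **stub 6 — automorphy over a CM field forces parallel gaps** (Clozel purity; citation-grade).
If `K'` is a CM number field, Galois over the imaginary quadratic `F`, and `ρ|Γ_{K'}` is automorphic
(`Qian2022.IsAutomorphic ι`: semisimple, `≅ r_ι(π)` for a regular algebraic cuspidal `π` of `GL₂(𝔸_{K'})` by HLTT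
Thm. A uniqueness + Chebotarev + Brauer–Nesbitt), then `ρ` cannot have two labels above `p` with DIFFERENT gaps:
the labelled Hodge–Tate weights of `ρ|Γ_{K'}` at a place `u ∣ v` are those of `ρ` at `v`
(`LabelledWeightsInvariance`), they are `{λ_{ιτ,1} + 1, λ_{ιτ,2}}` for the weight `λ` of `π` (A'Campo–Hevesi–
Thorne–Whitmore 2026 Thm. 1.2.1), and Clozel's purity lemma `λ_{σ,1} + λ_{cσ,2} = w = λ_{σ,2} + λ_{cσ,1}` makes
the gap at `σ` equal to the gap at `cσ`; complex conjugation of `K'` restricts to that of `F`, so it exchanges the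
places above `v` and above `v̄` — the two gaps of `ρ` agree.  Size L (citation-grade inputs + bookkeeping).
[cite: Clozel1990, Lemme 4.9 (purity)] [cite: Qian2022, Def. 1.3] -/
theorem stub_purityContradiction :
    ∀ (F : Type) [Field F] [NumberField F] [Algebra.IsQuadraticExtension ℚ F], NumberField.IsTotallyComplex F → ∀ (p : ℕ) [Fact p.Prime] (ρ : FramedGaloisRep F (PadicAlgCl p) 2), (∀ (v : HeightOneSpectrum (𝓞 F)) (hv : ((p : ℕ) : 𝓞 F) ∈ v.asIdeal), (fontainePstAdicCompletion v p hv).IsDeRhamFramed (ρ.toLocal v) ∧ (letI := (fontainePstAdicCompletion v p hv).algebra; ∀ τ : v.adicCompletion F →ₐ[ℚ_[p]] PadicAlgCl p, ∃ a b : ℤ, a < b ∧ ρ.labelledHodgeTateWeightsAt v (fontainePstAdicCompletion v p hv).algebra (fontainePstAdicCompletion v p hv).𝔅 τ.toRingHom = {a, b})) → (∃ (v : HeightOneSpectrum (𝓞 F)) (hv : ((p : ℕ) : 𝓞 F) ∈ v.asIdeal) (w : HeightOneSpectrum (𝓞 F)) (hw : ((p : ℕ) : 𝓞 F) ∈ w.asIdeal),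 letI := (fontainePstAdicCompletion v p hv).algebra; letI := (fontainePstAdicCompletion w p hw).algebra; ∃ (τ : v.adicCompletion F →ₐ[ℚ_[p]] PadicAlgCl p) (σ : w.adicCompletion F →ₐ[ℚ_[p]] PadicAlgCl p) (a b a' b' : ℤ), ρ.labelledHodgeTateWeightsAt v (fontainePstAdicCompletion v p hv).algebra (fontainePstAdicCompletion v p hv).𝔅 τ.toRingHom = {a, b} ∧ a < b ∧ ρ.labelledHodgeTateWeightsAt w (fontainePstAdicCompletion w p hw).algebra (fontainePstAdicCompletion w p hw).𝔅 σ.toRingHom = {a', b'} ∧ a' < b' ∧ b - a ≠ b' - a') → ∀ (ι : PadicAlgCl p ≃+* ℂ) (K' : Type) (_ : Field K') (_ : NumberField K') (_ : Algebra F K'), IsGalois F K' → NumberField.IsCMField K' → Qian2022.IsAutomorphic ι (ρ.restrictField K') → False := by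
  sorry

/-- **stub 7 — the supersingular dihedral corner (honest OPEN remainder of this crux; = sector S of
the strategist split `Split.lean`).**  The crux restricted to `ρ̄|Γ_{F(ζ_p)}` projectively dihedral AND no
invariant line at some `v ∣ p`.  No engine in print: the tensor induction is residually reducible on `Γ_{ℚ(ζ_p)}`
(BLGGT excluded), ordinary lifting / Qian excluded by the supersingular place, ACC+ Thm. 6.1.1 needs residual
automorphy IN the non-parallel weight (no cusp form has it), and BLGGT-style change of weight is unavailable at
defect one (purity is multiplicative: no pure automorphic avatar is congruent in the same weight).  Candidate
mechanisms recorded in STRATEGY-CENSUS.md: torsion-fed Fontaine–Laffaille emptiness (the sibling crux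
`EmptyWeightCore`: dihedral images are enormous and decomposed generic, so only the weight-part-of-Serre input
for `Ind θ̄` in a non-parallel Serre weight and the torsion-only patching `R^λ[1/p] = ∅` are missing), and
overconvergent classicality (refinements of a crystalline supersingular `ρ_v` are non-critical).  Size: open.
[cite: CalegariMazur2008, Conj. 1.3] [cite: CalegariGeraghty2017, §1] [cite: ACCGHLNSTT2023, Thm. 6.1.1] -/
theorem stub_supersingularDihedral :
    ∀ (F : Type) [Field F] [NumberField F] [Algebra.IsQuadraticExtension ℚ F], NumberField.IsTotallyComplex F → ∀ (p : ℕ) [Fact p.Prime] (ρ : FramedGaloisRep F (PadicAlgCl p) 2), ρ.toGaloisRep.IsIrreducible → (∀ᶠ v : HeightOneSpectrum (𝓞 F) in Filter.cofinite, ρ.IsUnramifiedAt v) → (∀ (v : HeightOneSpectrum (𝓞 F)) (hv : ((p : ℕ) : 𝓞 F) ∈ v.asIdeal), (fontainePstAdicCompletion v p hv).IsDeRhamFramed (ρ.toLocal v) ∧ (letI := (fontainePstAdicCompletion v p hv).algebra; ∀ τ : v.adicCompletion F →ₐ[ℚ_[p]] PadicAlgCl p, ∃ a b : ℤ, a < b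 ∧ ρ.labelledHodgeTateWeightsAt v (fontainePstAdicCompletion v p hv).algebra (fontainePstAdicCompletion v p hv).𝔅 τ.toRingHom = {a, b})) → (11 ≤ p ∧ (∃ v w : HeightOneSpectrum (𝓞 F), v ≠ w ∧ ((p : ℕ) : 𝓞 F) ∈ v.asIdeal ∧ ((p : ℕ) : 𝓞 F) ∈ w.asIdeal) ∧ (∀ (v : HeightOneSpectrum (𝓞 F)) (hv : ((p : ℕ) : 𝓞 F) ∈ v.asIdeal), (fontainePstAdicCompletion v p hv).IsCrystallineFramed (ρ.toLocal v)) ∧ FramedGaloisRep.IsResiduallyAbsIrreducible (ρ.restrictField (CyclotomicField p F))) → ¬ (∀ (v : HeightOneSpectrum (𝓞 F)) (hv : ((p : ℕ) : 𝓞 F) ∈ v.asIdeal) (w : HeightOneSpectrum (𝓞 F)) (hw : ((p : ℕ) : 𝓞 F) ∈ w.asIdeal), letI := (fontainePstAdicCompletion v p hv).algebra; letI := (fontainePstAdicCompletion w p hw).algebra; ∀ (τ : v.adicCompletion F →ₐ[ℚ_[p]] PadicAlgCl p) (σ : w.adicCompletion F →ₐ[ℚ_[p]] PadicAlgCl p)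 (a b a' b' : ℤ), ρ.labelledHodgeTateWeightsAt v (fontainePstAdicCompletion v p hv).algebra (fontainePstAdicCompletion v p hv).𝔅 τ.toRingHom = {a, b} → a < b → ρ.labelledHodgeTateWeightsAt w (fontainePstAdicCompletion w p hw).algebra (fontainePstAdicCompletion w p hw).𝔅 σ.toRingHom = {a', b'} → a' < b' → Even (b - a + (b' - a'))) → ¬ (∃ τ : absoluteGaloisGroup ℚ, τ ∉ Set.range (absGaloisRestrict ℚ F) ∧ ∃ χ : absoluteGaloisGroup F →* (padicAlgClResidueField p)ˣ, ∀ σ σ' : absoluteGaloisGroup F, absGaloisRestrict ℚ F σ' = τ * absGaloisRestrict ℚ F σ * τ⁻¹ → (ρ.residualRep σ').val.trace = (χ σ : padicAlgClResidueField p) * (ρ.residualRep σ).val.trace ∧ (ρ.residualRep σ').val.det = (χ σ : padicAlgClResidueField p) ^ 2 * (ρ.residualRep σ).val.det) → (∃ η : absoluteGaloisGroup (CyclotomicField p F) →* (padicAlgClResidueField p)ˣ, η ≠ 1 ∧ ∀ σ : absoluteGaloisGroup (CyclotomicField p F), (ρ.residualRep (absGaloisRestrict F (CyclotomicField p F) σ)).val.trace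 = (η σ : padicAlgClResidueField p) * (ρ.residualRep (absGaloisRestrict F (CyclotomicField p F) σ)).val.trace) → ¬ (∀ v : HeightOneSpectrum (𝓞 F), ((p : ℕ) : 𝓞 F) ∈ v.asIdeal → FramedRep.HasInvariantCompleteFlag (ρ.toLocal v)) → ∃ g : ℤ, ∀ (v : HeightOneSpectrum (𝓞 F)) (hv : ((p : ℕ) : 𝓞 F) ∈ v.asIdeal), letI := (fontainePstAdicCompletion v p hv).algebra; ∀ τ : v.adicCompletion F →ₐ[ℚ_[p]] PadicAlgCl p, ∃ a : ℤ, ρ.labelledHodgeTateWeightsAt v (fontainePstAdicCompletion v p hv).algebra (fontainePstAdicCompletion v p hv).𝔅 τ.toRingHom = {a, a + g} := by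
  sorry

/-! ## The stub statements as named `Prop`s (literally their types) — the registrar's by-name hypotheses -/

namespace _Goal

/-- The statement of `stub_genericSector`, as a named `Prop` (literally its type; no `sorry` in it). -/
def stub_genericSector : Prop :=
  type_of% @Summit.Langlands.Langlands.Cruxes.TensorSquareParallel.QianTransfer.stub_genericSector

/-- The statement of `stub_dihedralType_of_trace`, as a named `Prop` (literally its type; no `sorry` in it). -/
def stub_dihedralType_of_trace : Prop :=
  type_of% @Summit.Langlands.Langlands.Cruxes.TensorSquareParallel.QianTransfer.stub_dihedralType_of_trace

/-- The statement of `stub_isEnormous_of_isDihedralType`, as a named `Prop` (literally its type; no `sorry` in it). -/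
def stub_isEnormous_of_isDihedralType : Prop :=
  type_of% @Summit.Langlands.Langlands.Cruxes.TensorSquareParallel.QianTransfer.stub_isEnormous_of_isDihedralType

/-- The statement of `stub_qianResidualPackage`, as a named `Prop` (literally its type; no `sorry` in it). -/
def stub_qianResidualPackage : Prop :=
  type_of% @Summit.Langlands.Langlands.Cruxes.TensorSquareParallel.QianTransfer.stub_qianResidualPackage

/-- The statement of `stub_qianPotentialAutomorphy`, as a named `Prop` (literally its type; no `sorry` in it). -/
def stub_qianPotentialAutomorphy : Prop :=
  type_of% @Summit.Langlands.Langlands.Cruxes.TensorSquareParallel.QianTransfer.stub_qianPotentialAutomorphy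

/-- The statement of `stub_purityContradiction`, as a named `Prop` (literally its type; no `sorry` in it). -/
def stub_purityContradiction : Prop :=
  type_of% @Summit.Langlands.Langlands.Cruxes.TensorSquareParallel.QianTransfer.stub_purityContradiction

/-- The statement of `stub_supersingularDihedral`, as a named `Prop` (literally its type; no `sorry` in it). -/
def stub_supersingularDihedral : Prop :=
  type_of% @Summit.Langlands.Langlands.Cruxes.TensorSquareParallel.QianTransfer.stub_supersingularDihedral

end _Goal

/-- Read-back: the seven stubs prove their named statements (definitionally their own types). -/
theorem goals_hold :
    _Goal.stub_genericSector ∧ _Goal.stub_dihedralType_of_trace ∧ _Goal.stub_isEnormous_of_isDihedralType ∧ _Goal.stub_qianResidualPackage ∧ _Goal.stub_qianPotentialAutomorphy ∧ _Goal.stub_purityContradiction ∧ _Goal.stub_supersingularDihedral :=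
  ⟨stub_genericSector, stub_dihedralType_of_trace, stub_isEnormous_of_isDihedralType, stub_qianResidualPackage, stub_qianPotentialAutomorphy, stub_purityContradiction, stub_supersingularDihedral⟩

/-- **`TensorSquareParallel` from the seven stubs** — kernel-checked composition (no sorry).  Case split on
the projectively dihedral predicate over `F(ζ_p)`: off it, stub 1 (the birth line's sector); on it, case split on
near-ordinarity: no invariant line somewhere — stub 7 (open remainder); an invariant line everywhere — the odd-gap
clause yields two labels with different gaps, stub 2 gives dihedral type and coprimality of the residual image on
`Γ_{F(ζ_p)}`, stub 3 its enormousness, stub 4 Qian's residual package, stub 5 a CM field `K'` Galois over `F` with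
`ρ|Γ_{K'}` automorphic, and stub 6 the contradiction with the two different gaps.
[cite: Qian2022, Thm. 1.4] [cite: ACCGHLNSTT2023, Thm. 6.1.2] [cite: Clozel1990, Lemme 4.9] -/
theorem TensorSquareParallel_of
    (h₁ : _Goal.stub_genericSector) (h₂ : _Goal.stub_dihedralType_of_trace)
    (h₃ : _Goal.stub_isEnormous_of_isDihedralType) (h₄ : _Goal.stub_qianResidualPackage)
    (h₅ : _Goal.stub_qianPotentialAutomorphy) (h₆ : _Goal.stub_purityContradiction)
    (h₇ : _Goal.stub_supersingularDihedral) :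
    Summit.Langlands.Langlands.Theses.NonParallelVoid.TensorSquareParallel := by
  have HGS : type_of% @stub_genericSector := h₁
  have HDT : type_of% @stub_dihedralType_of_trace := h₂
  have HEN : type_of% @stub_isEnormous_of_isDihedralType := h₃
  have HRP : type_of% @stub_qianResidualPackage := h₄
  have HPA : type_of% @stub_qianPotentialAutomorphy := h₅
  have HPC : type_of% @stub_purityContradiction := h₆
  have HSS : type_of% @stub_supersingularDihedral := h₇
  clear h₁ h₂ h₃ h₄ h₅ h₆ h₇
  intro F _ _ _ hF p _ ρ hirr hunr hHT hG hE hB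
  by_cases hD : (∃ η : absoluteGaloisGroup (CyclotomicField p F) →* (padicAlgClResidueField p)ˣ, η ≠ 1 ∧ ∀ σ : absoluteGaloisGroup (CyclotomicField p F), (ρ.residualRep (absGaloisRestrict F (CyclotomicField p F) σ)).val.trace = (η σ : padicAlgClResidueField p) * (ρ.residualRep (absGaloisRestrict F (CyclotomicField p F) σ)).val.trace)
  · by_cases hLR : (∀ v : HeightOneSpectrum (𝓞 F), ((p : ℕ) : 𝓞 F) ∈ v.asIdeal → FramedRep.HasInvariantCompleteFlag (ρ.toLocal v))
    · -- the nearly ordinary dihedral corner is void: Qian's ordinary potential automorphy + purity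
      exfalso
      -- two labels with different gaps, from the failure of the parity clause
      have hNP : (∃ (v : HeightOneSpectrum (𝓞 F)) (hv : ((p : ℕ) : 𝓞 F) ∈ v.asIdeal) (w : HeightOneSpectrum (𝓞 F)) (hw : ((p : ℕ) : 𝓞 F) ∈ w.asIdeal), letI := (fontainePstAdicCompletion v p hv).algebra; letI := (fontainePstAdicCompletion w p hw).algebra; ∃ (τ : v.adicCompletion F →ₐ[ℚ_[p]] PadicAlgCl p) (σ : w.adicCompletion F →ₐ[ℚ_[p]] PadicAlgCl p) (a b a' b' : ℤ), ρ.labelledHodgeTateWeightsAt v (fontainePstAdicCompletion v p hv).algebra (fontainePstAdicCompletion v p hv).𝔅 τ.toRingHom = {a, b} ∧ a < b ∧ ρ.labelledHodgeTateWeightsAt w (fontainePstAdicCompletion w p hw).algebra (fontainePstAdicCompletion w p hw).𝔅 σ.toRingHom = {a', b'} ∧ a' < b' ∧ b - a ≠ b' - a') := by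
        by_contra hcon
        apply hE
        intro v hv w hw τ σ a b a' b' h1 h2 h3 h4
        by_contra hodd
        exact hcon ⟨v, hv, w, hw, τ, σ, a, b, a', b', h1, h2, h3, h4, fun heq => hodd ⟨b - a, by rw [← heq]⟩⟩
      have hp2 : p ≠ 2 := by
        have := hG.1
        omega
      -- stub 2: dihedral type, finiteness and coprimality of the residual image on Γ_(F(ζ_p))
      obtain ⟨hdt, hfin, hcop⟩ := HDT F hF p ρ hG.1 hG.2.2.2 hD
      -- stub 3: enormous
      have hEn := HEN p hp2 _ (ρ.residualRep.comp (absGaloisGroupAdjoinRootsOfUnity F p).subtype) hfin hcop hdt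
      -- stub 4: Qian's residual package
      have hRP := HRP F hF p ρ hG.1 hG.2.1 hG.2.2.2 hdt hEn
      -- stub 5: potential automorphy over a CM field K'
      obtain ⟨ι, K', iK1, iK2, iK3, hGal, hCM, hAut⟩ := HPA F hF p ρ hunr hHT hG.2.2.1 hLR hRP
      -- stub 6: purity contradiction
      exact HPC F hF p ρ hHT hNP ι K' iK1 iK2 iK3 hGal hCM hAut
    · exact HSS F hF p ρ hirr hunr hHT hG hE hB hD hLR
  · exact HGS F hF p ρ hirr hunr hHT hG hE hB hD

/-- By-name sanity check (an `example`, not a declaration): the seven stubs feed the composition as they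
stand — `TensorSquareParallel` modulo exactly the seven stubs (the only sorries of the file). -/
example : Summit.Langlands.Langlands.Theses.NonParallelVoid.TensorSquareParallel :=
  TensorSquareParallel_of stub_genericSector stub_dihedralType_of_trace stub_isEnormous_of_isDihedralType
    stub_qianResidualPackage stub_qianPotentialAutomorphy stub_purityContradiction stub_supersingularDihedral

end Summit.Langlands.Langlands.Cruxes.TensorSquareParallel.QianTransfer

end
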